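import Summits.AtomisticToContinuum.HydrodynamicLimit.Theorems.JaynesSqueezeBlockGibbsTransport
import Summits.AtomisticToContinuum.HydrodynamicLimit.Theorems.JaynesSqueezeBlockGibbsGaussianMoments
import Summits.AtomisticToContinuum.HydrodynamicLimit.Theorems.JaynesSqueezeBlockGibbsCorners
import Summits.AtomisticToContinuum.HydrodynamicLimit.Theorems.JParityClosureOddContactSymmetryGibbsInvariance
import HarnessLib

/-!
# `JaynesSqueeze.BlockGibbs` at time zero (support for stmt-AtomisticToContinuum-13462)

The typed waypoint `BlockGibbs` asks for block local Gibbsianity in specific relative entropy of the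
EVOLVED local Gibbs law at every `s ≤ t`. At `s = 0` nothing dynamical is involved and the statement
is a theorem, proved here for every particle number (not only eventually): for continuous positive data
`(a₀, u₀, θ₀)` and `σ ≤ 1/2` there are `A, Θ > 0`, `V` such that for every `δ > 0`, all block scales
`m ≥ m₀(δ)`, all `N` and all flows `Φ`, the block-constant reference obtained by SAMPLING the data
profiles at the cube corners `k/m` lies in the range `[A⁻¹, A] × {‖·‖ ≤ V} × [Θ⁻¹, Θ]` and
`klDiv(lawAt Φ λ_N 0 ‖ ψ_block) ≤ δ (N+1)` (`blockGibbs_timeZero`).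

Proof (all finite-`N`, explicit): the bookkeeping identity `klDiv_lawAt_blockRef_eq_ofReal` at
`t = 0` (`Φ₀ = id` a.s.), the pointwise decomposition
`log prof₀ − log prof_block = [log a₀ − log ca] + 3/2 log(cθ/θ₀) + ‖v − cu‖²/(2cθ) − ‖v − u₀‖²/(2θ₀)`,
the conditional Gaussian second moments of `JaynesSqueezeBlockGibbsGaussianMoments`
(`E[∑ ‖vᵢ − cu‖²/(2cθ)] ≤ (N+1)(3/2 + 4η/θ_min)`, `E[∑ ‖vᵢ − u₀(xᵢ)‖²/(2θ₀(xᵢ))] = (N+1)·3/2`), the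
log-partition comparison `|log Z_block − log Z₀| ≤ (N+1) η` (`abs_log_posPartition_sub_le`), and
uniform continuity of `log a₀, θ₀, u₀` on the compact torus (Heine–Cantor) to make the sampling error
`η` small for `m ≥ m₀`; the cube corner `(⌊m·repr x⌋/m)` is within `1/m` of `x` in each coordinate
(`norm_sub_corner_le`).

This is the `s = 0` certificate of `BlockGibbs` (non-vacuity and typing of its consequent;
`blockGibbs_of_eq_zero` restates it in the Theses' vocabulary). At POSITIVE times the only case settled
here is global equilibrium: for CONSTANT data profiles the local Gibbs law is invariant under every
hard-sphere flow (`map_flow_localGibbsLaw_const`), the constant block reference IS that law, and the whole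
consequent of `BlockGibbs` holds with `klDiv = 0` (`blockGibbs_of_const`). The general positive-time
statement is the open local-equilibrium problem (Yau 1991) and is NOT addressed here.
-/

noncomputable section

open MeasureTheory Filter Set Topology InformationTheory
open scoped ENNReal

namespace Summit.AtomisticToContinuum.HydrodynamicLimit.Theorems.BlockGibbsLine

open Literature.MathematicalPhysics.KineticTheory Literature.Analysis.FluidPDE
open Literature.Analysis.FunctionSpaces

/-! ## The time-zero certificate -/

section TimeZero

variable {a₀ θ₀ : T3 → ℝ} {u₀ : T3 → V3} {σ : ℝ}

-- 2026-08-17 full-build repair: `lake build` timed out here at the default 200000 heartbeats (farm usage was in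
-- (175k, 200k]); Step 8's `nlinarith` is now a `linarith` (usage in (125k, 150k]) and the budget is doubled as margin.
set_option maxHeartbeats 400000 in
/-- **`BlockGibbs` at time zero.** For continuous positive data `(a₀, u₀, θ₀)` and `σ ≤ 1/2` there are
`A, Θ > 0` and `V` such that for every `δ > 0` there is a block scale `m₀` beyond which, for EVERY
particle number `N + 1` and every hard-sphere flow `Φ`, the block-constant local Gibbs reference sampling
the data at the cube corners has parameters in `[A⁻¹, A] × {‖·‖ ≤ V} × [Θ⁻¹, Θ]` and
`klDiv(lawAt Φ λ_N 0 ‖ ψ_block) ≤ δ (N + 1)`. [folklore] -/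
theorem blockGibbs_timeZero (hσ2 : σ ≤ 1 / 2) (ha : Continuous a₀) (hθ : Continuous θ₀) (hu : Continuous u₀)
    (ha0 : ∀ x, 0 < a₀ x) (hθ0 : ∀ x, 0 < θ₀ x) :
    ∃ A Θ V : ℝ, 0 < A ∧ 0 < Θ ∧ ∀ δ : ℝ, 0 < δ → ∃ m₀ : ℕ, ∀ m : ℕ, m₀ ≤ m →
      ∀ (N : ℕ) (Φ : HardSphereFlow (Torus.geometry (Fin 3)) (hsDiameter σ N) (N + 1)),
        ∃ (ca cθ : (Fin 3 → ℕ) → ℝ) (cu : (Fin 3 → ℕ) → V3),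
          (∀ k, A⁻¹ ≤ ca k ∧ ca k ≤ A ∧ Θ⁻¹ ≤ cθ k ∧ cθ k ≤ Θ ∧ ‖cu k‖ ≤ V) ∧
          klDiv (Φ.lawAt (localGibbsLaw σ a₀ u₀ θ₀ N Φ) 0)
              (localGibbsLaw σ (fun x => ca (fun i : Fin 3 => ⌊(m : ℝ) * Torus.repr x i⌋₊))
                (fun x => cu (fun i : Fin 3 => ⌊(m : ℝ) * Torus.repr x i⌋₊))
                (fun x => cθ (fun i : Fin 3 => ⌊(m : ℝ) * Torus.repr x i⌋₊)) N Φ) ≤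
            ENNReal.ofReal (δ * ((N : ℝ) + 1)) := by
  /- Step 0: a priori range of the data. -/
  obtain ⟨amin, hamin, hamin'⟩ := exists_pos_forall_le_of_continuous ha ha0
  obtain ⟨θmin, hθmin, hθmin'⟩ := exists_pos_forall_le_of_continuous hθ hθ0
  obtain ⟨amax, -, hamax⟩ := exists_forall_abs_le_of_continuous ha
  obtain ⟨θmax, -, hθmax⟩ := exists_forall_abs_le_of_continuous hθ
  obtain ⟨U, -, hU⟩ := exists_forall_abs_le_of_continuous hu.norm
  have hamax' : ∀ x, a₀ x ≤ amax := fun x => (le_abs_self _).trans (hamax x)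
  have hθmax' : ∀ x, θ₀ x ≤ θmax := fun x => (le_abs_self _).trans (hθmax x)
  have hU' : ∀ x, ‖u₀ x‖ ≤ U := fun x => by simpa using hU x
  set A : ℝ := max amax amin⁻¹ with hA
  set Θ : ℝ := max θmax θmin⁻¹ with hΘ
  have hApos : 0 < A := lt_max_of_lt_right (inv_pos.2 hamin)
  have hΘpos : 0 < Θ := lt_max_of_lt_right (inv_pos.2 hθmin)
  have hArange : ∀ y, A⁻¹ ≤ a₀ y ∧ a₀ y ≤ A := fun y =>
    ⟨(inv_le_of_inv_le₀ hamin (le_max_right _ _)).trans (hamin' y), (hamax' y).trans (le_max_left _ _)⟩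
  have hΘrange : ∀ y, Θ⁻¹ ≤ θ₀ y ∧ θ₀ y ≤ Θ := fun y =>
    ⟨(inv_le_of_inv_le₀ hθmin (le_max_right _ _)).trans (hθmin' y), (hθmax' y).trans (le_max_left _ _)⟩
  refine ⟨A, Θ, U, hApos, hΘpos, fun δ hδ => ?_⟩
  /- Step 1: the tolerance `η` and the block scale `m₀` (uniform continuity). -/
  set K : ℝ := 2 + 6 / θmin with hK
  have hKpos : 0 < K := by positivity
  set η : ℝ := min (min 1 (θmin / 2)) (δ / K) with hη
  have hηpos : 0 < η := lt_min (lt_min one_pos (half_pos hθmin)) (div_pos hδ hKpos)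
  have hη1 : η ≤ 1 := (min_le_left _ _).trans (min_le_left _ _)
  have hηθ : η ≤ θmin / 2 := (min_le_left _ _).trans (min_le_right _ _)
  have hηδ : η * K ≤ δ := by
    have : η ≤ δ / K := min_le_right _ _
    rwa [le_div_iff₀ hKpos] at this
  have hloga : Continuous fun x => Real.log (a₀ x) := ha.log fun x => (ha0 x).ne'
  obtain ⟨δa, hδa, hδa'⟩ := exists_forall_dist_lt_of_continuous hloga hηpos
  obtain ⟨δθ, hδθ, hδθ'⟩ := exists_forall_dist_lt_of_continuous hθ hηpos
  obtain ⟨δu, hδu, hδu'⟩ := exists_forall_dist_lt_of_continuous hu hηpos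
  set δ₀ : ℝ := min δa (min δθ δu) with hδ₀
  have hδ₀pos : 0 < δ₀ := lt_min hδa (lt_min hδθ hδu)
  refine ⟨⌈δ₀⁻¹⌉₊ + 1, fun m hm N Φ => ?_⟩
  have hm0 : 0 < m := lt_of_lt_of_le (Nat.succ_pos _) hm
  have hm' : (0 : ℝ) < m := by exact_mod_cast hm0
  have hm_inv : 1 / (m : ℝ) < δ₀ := by
    rw [one_div, inv_lt_comm₀ hm' hδ₀pos]
    calc δ₀⁻¹ ≤ ⌈δ₀⁻¹⌉₊ := Nat.le_ceil _
      _ < (⌈δ₀⁻¹⌉₊ : ℝ) + 1 := lt_add_one _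
      _ ≤ m := by exact_mod_cast hm
  /- Step 2: the corner map and the block parameters. -/
  set cpt : T3 → T3 := fun x => fun i : Fin 3 =>
    ((((⌊(m : ℝ) * Torus.repr x i⌋₊ : ℝ) / m : ℝ) : UnitAddCircle)) with hcpt
  have hclose : ∀ x, dist x (cpt x) < δ₀ := fun x => (dist_corner_le hm0 x).trans_lt hm_inv
  have hUa : ∀ x, |Real.log (a₀ x) - Real.log (a₀ (cpt x))| ≤ η := fun x => by
    have h := hδa' x (cpt x) ((hclose x).trans_le (min_le_left _ _))
    rw [Real.dist_eq] at h
    exact h.le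
  have hUθ : ∀ x, |θ₀ x - θ₀ (cpt x)| ≤ η := fun x => by
    have h := hδθ' x (cpt x) ((hclose x).trans_le ((min_le_right _ _).trans (min_le_left _ _)))
    rw [Real.dist_eq] at h
    exact h.le
  have hUu : ∀ x, ‖u₀ x - u₀ (cpt x)‖ ≤ η := fun x => by
    have h := hδu' x (cpt x) ((hclose x).trans_le ((min_le_right _ _).trans (min_le_right _ _)))
    rw [dist_eq_norm] at h
    exact h.le
  set ca : (Fin 3 → ℕ) → ℝ := fun k => a₀ (fun i : Fin 3 => ((((k i : ℕ) : ℝ) / m : ℝ) : UnitAddCircle)) with hca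
  set cθ : (Fin 3 → ℕ) → ℝ := fun k => θ₀ (fun i : Fin 3 => ((((k i : ℕ) : ℝ) / m : ℝ) : UnitAddCircle)) with hcθ
  set cu : (Fin 3 → ℕ) → V3 := fun k => u₀ (fun i : Fin 3 => ((((k i : ℕ) : ℝ) / m : ℝ) : UnitAddCircle)) with hcu
  -- the block profiles are the data at the corners
  have hca' : ∀ x, ca (fun i : Fin 3 => ⌊(m : ℝ) * Torus.repr x i⌋₊) = a₀ (cpt x) := fun x => rfl
  have hcθ' : ∀ x, cθ (fun i : Fin 3 => ⌊(m : ℝ) * Torus.repr x i⌋₊) = θ₀ (cpt x) := fun x => rfl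
  have hcu' : ∀ x, cu (fun i : Fin 3 => ⌊(m : ℝ) * Torus.repr x i⌋₊) = u₀ (cpt x) := fun x => rfl
  have hR : ∀ k, A⁻¹ ≤ ca k ∧ ca k ≤ A ∧ Θ⁻¹ ≤ cθ k ∧ cθ k ≤ Θ ∧ ‖cu k‖ ≤ U := fun k =>
    ⟨(hArange _).1, (hArange _).2, (hΘrange _).1, (hΘrange _).2, hU' _⟩
  refine ⟨ca, cθ, cu, hR, ?_⟩
  /- Step 3: the bookkeeping identity at `t = 0`. -/
  rw [klDiv_lawAt_blockRef_eq_ofReal hσ2 Φ ha hθ hu ha0 hθ0 hApos hΘpos hR m 0]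
  refine ENNReal.ofReal_le_ofReal ?_
  -- abbreviations for the block profiles as functions on `𝕋³`
  set ab : T3 → ℝ := fun x => ca (fun i : Fin 3 => ⌊(m : ℝ) * Torus.repr x i⌋₊) with hab
  set θb : T3 → ℝ := fun x => cθ (fun i : Fin 3 => ⌊(m : ℝ) * Torus.repr x i⌋₊) with hθb
  set ub : T3 → V3 := fun x => cu (fun i : Fin 3 => ⌊(m : ℝ) * Torus.repr x i⌋₊) with hub
  have habm : Measurable ab := measurable_comp_blockIdx ca m
  have hθbm : Measurable θb := measurable_comp_blockIdx cθ m
  have hubm : Measurable ub := measurable_comp_blockIdx cu m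
  have hab0 : ∀ x, 0 < ab x := fun x => ha0 _
  have hθb0 : ∀ x, 0 < θb x := fun x => hθ0 _
  have habA : ∀ x, ab x ≤ amax := fun x => hamax' _
  have hθbmin : ∀ x, θmin - η ≤ θb x := fun x => by
    have := (abs_le.1 (hUθ x)).2; have := hθmin' x; rw [hθb]; simp only [hcθ']; linarith
  have hθbmin' : ∀ x, θmin / 2 ≤ θb x := fun x => by linarith [hθbmin x]
  -- the law and its basic properties
  haveI hprob : IsProbabilityMeasure (localGibbsLaw σ a₀ u₀ θ₀ N Φ) :=
    isProbabilityMeasure_localGibbsLaw ha hθ hu ha0 hθ0 hσ2 N Φ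
  haveI hprobM : IsProbabilityMeasure (localGibbsMeasure σ a₀ u₀ θ₀ N) :=
    isProbabilityMeasure_localGibbsMeasure ha hθ hu ha0 hθ0 hσ2 N
  have hac : localGibbsLaw σ a₀ u₀ θ₀ N Φ ≪ liouville (Torus.geometry (Fin 3)) (N + 1) (hsDiameter σ N) := by
    rw [localGibbsLaw, particleLaw_eq]; exact withDensity_absolutelyContinuous _ _
  /- Step 4: `Φ₀ = id` a.s.: the reference pairing at time `0` is the pairing at the configuration. -/
  have hflow0 : (∫ z, (∫ y, Real.log (localGibbsProfile ab ub θb y) ∂(empiricalMeasure (Φ.flow 0 z)))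
      ∂(localGibbsLaw σ a₀ u₀ θ₀ N Φ)) =
      ∫ z, (∫ y, Real.log (localGibbsProfile ab ub θb y) ∂(empiricalMeasure z)) ∂(localGibbsLaw σ a₀ u₀ θ₀ N Φ) := by
    refine integral_congr_ae ?_
    filter_upwards [hac.ae_le Φ.ae_mem_good] with z hz
    rw [Φ.flow_zero z hz]
  rw [hflow0]
  /- Step 5: integrability of the two pairings and the pointwise decomposition. -/
  have hK0 := JaynesSqueezeSqueeze.integrable_kineticPair_localGibbsLaw hσ2 ha hθ hu ha0 hθ0 N Φ
  have hI₀ : Integrable (fun z => ∫ y, Real.log (localGibbsProfile a₀ u₀ θ₀ y) ∂(empiricalMeasure z))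
      (localGibbsLaw σ a₀ u₀ θ₀ N Φ) :=
    MacroClosureLine.StubLedger.integrable_logPair_comp ha hθ hu ha0 hθ0 measurable_id hK0
  have hIb : Integrable (fun z => ∫ y, Real.log (localGibbsProfile ab ub θb y) ∂(empiricalMeasure z))
      (localGibbsLaw σ a₀ u₀ θ₀ N Φ) :=
    (integrable_logPair_comp_of_bounds hApos hΘpos habm hθbm hubm (fun x => ⟨(hR _).1, (hR _).2.1⟩)
      (fun x => ⟨(hR _).2.2.1, (hR _).2.2.2.1⟩) (fun x => (hR _).2.2.2.2) measurable_id hK0).1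
  -- the three one-body sums
  set P : Config (N + 1) (Fin 3) T3 → ℝ := fun z => ∑ i,
    ((Real.log (a₀ (z i).1) - Real.log (ab (z i).1)) + 3 / 2 * (Real.log (θb (z i).1) - Real.log (θ₀ (z i).1)))
    with hP
  set Qb : Config (N + 1) (Fin 3) T3 → ℝ := fun z => ∑ i, (2 * θb (z i).1)⁻¹ * ‖(z i).2 - ub (z i).1‖ ^ 2 with hQb
  set Q0 : Config (N + 1) (Fin 3) T3 → ℝ := fun z => ∑ i, (2 * θ₀ (z i).1)⁻¹ * ‖(z i).2 - u₀ (z i).1‖ ^ 2 with hQ0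
  have hdecomp : ∀ z : Config (N + 1) (Fin 3) T3,
      (∫ y, Real.log (localGibbsProfile a₀ u₀ θ₀ y) ∂(empiricalMeasure z)) -
        (∫ y, Real.log (localGibbsProfile ab ub θb y) ∂(empiricalMeasure z)) =
      ((N : ℝ) + 1)⁻¹ * (P z + Qb z - Q0 z) := by
    intro z
    rw [MacroClosureLine.StubLedger.logPair_eq_sum, MacroClosureLine.StubLedger.logPair_eq_sum, ← mul_sub,
      ← Finset.sum_sub_distrib]
    congr 1
    simp only [hP, hQb, hQ0, ← Finset.sum_add_distrib, ← Finset.sum_sub_distrib]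
    refine Finset.sum_congr rfl fun i _ => ?_
    have h := log_localGibbsProfile_sub (a₁ := a₀) (θ₁ := θ₀) (u₁ := u₀) (a₂ := ab) (θ₂ := θb) (u₂ := ub)
      (z i).1 (z i).2 (ha0 _) (hθ0 _) (hab0 _) (hθb0 _)
    rw [show ((z i).1, (z i).2) = z i from rfl] at h
    rw [h]
  /- Step 6: the three expectations. -/
  -- (P) pointwise bound
  have hPbd : ∀ z, P z ≤ ((N : ℝ) + 1) * (η + 3 / 2 * (η / θmin)) := by
    intro z
    have hterm : ∀ i : Fin (N + 1),
        (Real.log (a₀ (z i).1) - Real.log (ab (z i).1)) + 3 / 2 * (Real.log (θb (z i).1) - Real.log (θ₀ (z i).1)) ≤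
          η + 3 / 2 * (η / θmin) := by
      intro i
      set x := (z i).1
      have h1 : Real.log (a₀ x) - Real.log (ab x) ≤ η := by
        have := (abs_le.1 (hUa x)).2; rw [hab]; simp only [hca']; linarith
      have h2 : Real.log (θb x) - Real.log (θ₀ x) ≤ η / θmin := by
        have hd : θb x - θ₀ x ≤ η := by
          have := (abs_le.1 (hUθ x)).1; rw [hθb]; simp only [hcθ']; linarith
        exact log_sub_log_le_of_sub_le hθmin hηpos.le (hθmin' x) (hθb0 x) hd
      linarith
    calc P z = ∑ i, ((Real.log (a₀ (z i).1) - Real.log (ab (z i).1)) +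
          3 / 2 * (Real.log (θb (z i).1) - Real.log (θ₀ (z i).1))) := rfl
      _ ≤ ∑ _i : Fin (N + 1), (η + 3 / 2 * (η / θmin)) := Finset.sum_le_sum fun i _ => hterm i
      _ = ((N : ℝ) + 1) * (η + 3 / 2 * (η / θmin)) := by
          rw [Finset.sum_const, Finset.card_univ, Fintype.card_fin, nsmul_eq_mul]; push_cast; ring
  have hPabs : ∀ z, |P z| ≤ ((N : ℝ) + 1) * (2 * Real.log A + 3 / 2 * (2 * Real.log Θ)) := by
    intro z
    have hterm : ∀ i : Fin (N + 1),
        |(Real.log (a₀ (z i).1) - Real.log (ab (z i).1)) + 3 / 2 * (Real.log (θb (z i).1) - Real.log (θ₀ (z i).1))| ≤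
          2 * Real.log A + 3 / 2 * (2 * Real.log Θ) := by
      intro i
      set x := (z i).1
      have h1 := abs_log_le_log_of_bounds hApos (hArange x).1 (hArange x).2
      have h2 : |Real.log (ab x)| ≤ Real.log A := abs_log_le_log_of_bounds hApos (hR _).1 (hR _).2.1
      have h3 := abs_log_le_log_of_bounds hΘpos (hΘrange x).1 (hΘrange x).2
      have h4 : |Real.log (θb x)| ≤ Real.log Θ := abs_log_le_log_of_bounds hΘpos (hR _).2.2.1 (hR _).2.2.2.1
      have hA1 := abs_le.1 h1; have hA2 := abs_le.1 h2; have hA3 := abs_le.1 h3; have hA4 := abs_le.1 h4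
      rw [abs_le]; constructor <;> nlinarith
    calc |P z| ≤ ∑ i, |(Real.log (a₀ (z i).1) - Real.log (ab (z i).1)) +
          3 / 2 * (Real.log (θb (z i).1) - Real.log (θ₀ (z i).1))| := Finset.abs_sum_le_sum_abs _ _
      _ ≤ ∑ _i : Fin (N + 1), (2 * Real.log A + 3 / 2 * (2 * Real.log Θ)) := Finset.sum_le_sum fun i _ => hterm i
      _ = ((N : ℝ) + 1) * (2 * Real.log A + 3 / 2 * (2 * Real.log Θ)) := by
          rw [Finset.sum_const, Finset.card_univ, Fintype.card_fin, nsmul_eq_mul]; push_cast; ring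
  have hPm : Measurable P := by
    refine Finset.measurable_sum _ fun i _ => ?_
    exact ((Real.measurable_log.comp (ha.measurable.comp (measurable_pi_apply i).fst)).sub
      (Real.measurable_log.comp (habm.comp (measurable_pi_apply i).fst))).add
      (measurable_const.mul ((Real.measurable_log.comp (hθbm.comp (measurable_pi_apply i).fst)).sub
        (Real.measurable_log.comp (hθ.measurable.comp (measurable_pi_apply i).fst))))
  have hPi : Integrable P (localGibbsLaw σ a₀ u₀ θ₀ N Φ) :=
    Integrable.of_bound hPm.aestronglyMeasurable _ (ae_of_all _ fun z => by rw [Real.norm_eq_abs]; exact hPabs z)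
  have hPint : ∫ z, P z ∂(localGibbsLaw σ a₀ u₀ θ₀ N Φ) ≤ ((N : ℝ) + 1) * (η + 3 / 2 * (η / θmin)) := by
    calc ∫ z, P z ∂(localGibbsLaw σ a₀ u₀ θ₀ N Φ)
        ≤ ∫ _z, ((N : ℝ) + 1) * (η + 3 / 2 * (η / θmin)) ∂(localGibbsLaw σ a₀ u₀ θ₀ N Φ) :=
          integral_mono hPi (integrable_const _) hPbd
      _ = ((N : ℝ) + 1) * (η + 3 / 2 * (η / θmin)) := by rw [integral_const, smul_eq_mul, probReal_univ, one_mul]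
  -- (Qb) conditional Gaussian bound with `B = 3/2 + 4η/θmin`
  have hκbm : Measurable fun y => (2 * θb y)⁻¹ := (measurable_const.mul hθbm).inv
  have hκb0 : ∀ y, 0 ≤ (2 * θb y)⁻¹ := fun y => inv_nonneg.2 (mul_nonneg zero_le_two (hθb0 y).le)
  have hBb : ∀ y, (2 * θb y)⁻¹ * (3 * θ₀ y + ‖u₀ y - ub y‖ ^ 2) ≤ 3 / 2 + 4 * η / θmin := by
    intro y
    have hθy : θ₀ y ≤ θb y + η := by
      have := (abs_le.1 (hUθ y)).2; rw [hθb]; simp only [hcθ']; linarith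
    have huy : ‖u₀ y - ub y‖ ^ 2 ≤ η ^ 2 := by
      have h := hUu y
      rw [hub]; simp only [hcu']
      exact pow_le_pow_left₀ (norm_nonneg _) h 2
    exact weightBound_of_close hθmin hηpos.le hη1 (hθbmin' y) hθy huy
  have hQbint : ∫ z, Qb z ∂(localGibbsLaw σ a₀ u₀ θ₀ N Φ) ≤ ((N : ℝ) + 1) * (3 / 2 + 4 * η / θmin) := by
    rw [localGibbsLaw_eq]
    exact integral_sum_mul_norm_sub_sq_localGibbsMeasure_le (κ := fun y => (2 * θb y)⁻¹) (c := ub)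
      ha.measurable hθ.measurable hu.measurable (fun x => (ha0 x).le) hθ0 σ N hκbm hubm hκb0 hBb
  have hQbi : Integrable Qb (localGibbsLaw σ a₀ u₀ θ₀ N Φ) := by
    rw [localGibbsLaw_eq]
    exact integrable_sum_mul_norm_sub_sq_localGibbsMeasure (κ := fun y => (2 * θb y)⁻¹) (c := ub)
      ha.measurable hθ.measurable hu.measurable (fun x => (ha0 x).le) hθ0 σ N hκbm hubm hκb0 hBb
  -- (Q0) equipartition
  have hQ0int : ∫ z, Q0 z ∂(localGibbsLaw σ a₀ u₀ θ₀ N Φ) = ((N : ℝ) + 1) * (3 / 2) := by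
    rw [localGibbsLaw_eq]
    exact integral_sum_norm_sub_sq_div_localGibbsMeasure_eq (a₀ := a₀) (θ₀ := θ₀) (u₀ := u₀)
      ha.measurable hθ.measurable hu.measurable (fun x => (ha0 x).le) hθ0 σ N
  have hQ0i : Integrable Q0 (localGibbsLaw σ a₀ u₀ θ₀ N Φ) := by
    rw [localGibbsLaw_eq]
    exact integrable_sum_norm_sub_sq_div_localGibbsMeasure (a₀ := a₀) (θ₀ := θ₀) (u₀ := u₀)
      ha.measurable hθ.measurable hu.measurable (fun x => (ha0 x).le) hθ0 σ N
  /- Step 7: the log-partition comparison. -/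
  have hZ : Real.log (canonicalPartition (Torus.geometry (Fin 3)) (hsDiameter σ N) (N + 1) (localGibbsProfile ab ub θb)) -
      Real.log (canonicalPartition (Torus.geometry (Fin 3)) (hsDiameter σ N) (N + 1) (localGibbsProfile a₀ u₀ θ₀)) ≤
      ((N : ℝ) + 1) * η := by
    rw [canonicalPartition_eq_posPartition' habm hθbm hubm (fun x => (hab0 x).le) hθb0,
      canonicalPartition_eq_posPartition ha hθ hu (fun x => (ha0 x).le) hθ0]
    have h := abs_log_posPartition_sub_le habm ha.measurable hab0 ha0 habA hamax' (η := η)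
      (fun x => by rw [abs_sub_comm]; rw [hab]; simp only [hca']; exact hUa x) hσ2 N
    exact (le_abs_self _).trans h
  /- Step 8: assembly. -/
  have hsub : (∫ z, (∫ y, Real.log (localGibbsProfile a₀ u₀ θ₀ y) ∂(empiricalMeasure z)) ∂(localGibbsLaw σ a₀ u₀ θ₀ N Φ)) -
      ∫ z, (∫ y, Real.log (localGibbsProfile ab ub θb y) ∂(empiricalMeasure z)) ∂(localGibbsLaw σ a₀ u₀ θ₀ N Φ) =
      ((N : ℝ) + 1)⁻¹ * ((∫ z, P z ∂(localGibbsLaw σ a₀ u₀ θ₀ N Φ)) + (∫ z, Qb z ∂(localGibbsLaw σ a₀ u₀ θ₀ N Φ)) -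
        ∫ z, Q0 z ∂(localGibbsLaw σ a₀ u₀ θ₀ N Φ)) := by
    rw [← integral_sub hI₀ hIb]
    simp_rw [hdecomp]
    have hPQ : Integrable (fun z => P z + Qb z) (localGibbsLaw σ a₀ u₀ θ₀ N Φ) := hPi.add hQbi
    have hPQQ : Integrable (fun z => P z + Qb z - Q0 z) (localGibbsLaw σ a₀ u₀ θ₀ N Φ) := hPQ.sub hQ0i
    rw [integral_const_mul, integral_sub hPQ hQ0i, integral_add hPi hQbi]
  rw [hsub]
  have hN : (0 : ℝ) < (N : ℝ) + 1 := by positivity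
  rw [← mul_assoc, mul_inv_cancel₀ hN.ne', one_mul]
  have htot : (∫ z, P z ∂(localGibbsLaw σ a₀ u₀ θ₀ N Φ)) + (∫ z, Qb z ∂(localGibbsLaw σ a₀ u₀ θ₀ N Φ)) -
      (∫ z, Q0 z ∂(localGibbsLaw σ a₀ u₀ θ₀ N Φ)) +
      (Real.log (canonicalPartition (Torus.geometry (Fin 3)) (hsDiameter σ N) (N + 1) (localGibbsProfile ab ub θb)) -
        Real.log (canonicalPartition (Torus.geometry (Fin 3)) (hsDiameter σ N) (N + 1) (localGibbsProfile a₀ u₀ θ₀))) ≤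
      ((N : ℝ) + 1) * (η * K) := by
    rw [hQ0int]
    have hinner : η + 3 / 2 * (η / θmin) + (3 / 2 + 4 * η / θmin) - 3 / 2 + η ≤ η * K := by
      rw [hK]
      have hpos : 0 ≤ η / θmin := div_nonneg hηpos.le hθmin.le
      have e1 : 4 * η / θmin = 4 * (η / θmin) := by ring
      have e2 : η * (2 + 6 / θmin) = 2 * η + 6 * (η / θmin) := by ring
      rw [e1, e2]
      linarith [hpos]
    have h6 : ((N : ℝ) + 1) * (η + 3 / 2 * (η / θmin)) + ((N : ℝ) + 1) * (3 / 2 + 4 * η / θmin) -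
        ((N : ℝ) + 1) * (3 / 2) + ((N : ℝ) + 1) * η ≤ ((N : ℝ) + 1) * (η * K) := by
      calc ((N : ℝ) + 1) * (η + 3 / 2 * (η / θmin)) + ((N : ℝ) + 1) * (3 / 2 + 4 * η / θmin) -
            ((N : ℝ) + 1) * (3 / 2) + ((N : ℝ) + 1) * η
          = ((N : ℝ) + 1) * (η + 3 / 2 * (η / θmin) + (3 / 2 + 4 * η / θmin) - 3 / 2 + η) := by ring
        _ ≤ ((N : ℝ) + 1) * (η * K) := mul_le_mul_of_nonneg_left hinner hN.le
    linarith [hPint, hQbint, hZ, h6]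
  calc _ ≤ ((N : ℝ) + 1) * (η * K) := by linarith [htot]
    _ ≤ ((N : ℝ) + 1) * δ := mul_le_mul_of_nonneg_left hηδ hN.le
    _ = δ * ((N : ℝ) + 1) := mul_comm _ _

/-- **`BlockGibbs` restricted to `t = 0`, in the Theses' own vocabulary.** The statement
`JaynesSqueeze.BlockGibbs` with its time parameter pinned to `t = 0` (one extra hypothesis `t = 0`;
`σ₀ = 1/2`, any `ηc`): the typed consequent of the waypoint — compact parameter range, block-constant
reference through `⌊m · repr x i⌋₊`, `klDiv ≤ ofReal (δ (N+1))` eventually in `N` — is exactly what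
`blockGibbs_timeZero` provides (for every `N`). Nothing is claimed at positive times. [folklore] -/
theorem blockGibbs_of_eq_zero :
    ∀ (a₀ θ₀ : (UnitAddTorus (Fin 3)) → ℝ) (u₀ : (UnitAddTorus (Fin 3)) → (EuclideanSpace ℝ (Fin 3))),
      Continuous a₀ → Continuous θ₀ → Continuous u₀ → (∀ x, 0 < a₀ x) → (∀ x, 0 < θ₀ x) →
      ∃ σ₀ : ℝ, 0 < σ₀ ∧ ∃ ηc : ℝ, 0 < ηc ∧ ∀ σ : ℝ, 0 < σ → σ < σ₀ →
        ∀ (T : ℝ) (ρ θ : ℝ → (UnitAddTorus (Fin 3)) → ℝ) (u : ℝ → (UnitAddTorus (Fin 3)) → (EuclideanSpace ℝ (Fin 3))),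
          IsHardSphereEulerSolution σ T ρ u θ →
          ∀ Φ : (N : ℕ) → HardSphereFlow (Torus.geometry (Fin 3)) (hsDiameter σ N) (N + 1),
            TendstoHydroFieldsAt (fun N => localGibbsLaw σ a₀ u₀ θ₀ N (Φ N)) Φ ρ u θ 0 →
            ∀ t ∈ Set.Ico 0 T, t = 0 → (∀ s ∈ Set.Icc 0 t, ∀ x, ρ s x * σ ^ 3 ≤ ηc) →
              let P : (N : ℕ) → Measure (Config (N + 1) (Fin 3) (UnitAddTorus (Fin 3))) :=
                fun N => localGibbsLaw σ a₀ u₀ θ₀ N (Φ N)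
              let idx : ℕ → (UnitAddTorus (Fin 3)) → (Fin 3 → ℕ) := fun m x i => ⌊(m : ℝ) * Torus.repr x i⌋₊
              ∃ A Θ V : ℝ, 0 < A ∧ 0 < Θ ∧ ∀ δ : ℝ, 0 < δ → ∃ m₀ : ℕ, ∀ m : ℕ, m₀ ≤ m →
                ∀ᶠ N : ℕ in Filter.atTop, ∀ s ∈ Set.Icc 0 t,
                  ∃ (ca cθ : (Fin 3 → ℕ) → ℝ) (cu : (Fin 3 → ℕ) → (EuclideanSpace ℝ (Fin 3))),
                    (∀ k, A⁻¹ ≤ ca k ∧ ca k ≤ A ∧ Θ⁻¹ ≤ cθ k ∧ cθ k ≤ Θ ∧ ‖cu k‖ ≤ V) ∧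
                    klDiv ((Φ N).lawAt (P N) s) (localGibbsLaw σ (fun x => ca (idx m x))
                      (fun x => cu (idx m x)) (fun x => cθ (idx m x)) N (Φ N)) ≤ ENNReal.ofReal (δ * ((N : ℝ) + 1)) := by
  intro a₀ θ₀ u₀ ha hθ hu ha0 hθ0
  refine ⟨1 / 2, by norm_num, 1, one_pos, fun σ _ hσ T ρ θ u _ Φ _ t _ ht0 _ => ?_⟩
  subst ht0
  dsimp only
  obtain ⟨A, Θ, V, hA, hΘ, h⟩ := blockGibbs_timeZero (a₀ := a₀) (θ₀ := θ₀) (u₀ := u₀) hσ.le ha hθ hu ha0 hθ0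
  refine ⟨A, Θ, V, hA, hΘ, fun δ hδ => ?_⟩
  obtain ⟨m₀, hm₀⟩ := h δ hδ
  refine ⟨m₀, fun m hm => Filter.Eventually.of_forall fun N s hs => ?_⟩
  obtain rfl : s = 0 := le_antisymm hs.2 hs.1
  exact hm₀ m hm N (Φ N)

/-- **`BlockGibbs` for constant data (global equilibrium), all times.** With constant profiles
`(a, uₑ, θₑ)` (`a, θₑ > 0`) the statement `JaynesSqueeze.BlockGibbs` holds outright: the local Gibbs law is
invariant under every hard-sphere flow (`map_flow_localGibbsLaw_const`: Liouville + conservation of energy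
and momentum), the constant block reference `ca = a, cu = uₑ, cθ = θₑ` is that very law, and
`klDiv(lawAt Φ λ_N s ‖ λ_N) = klDiv(λ_N ‖ λ_N) = 0` for all `s` ("global equilibrium passes trivially").
[folklore] -/
theorem blockGibbs_of_const (a θe : ℝ) (ue : EuclideanSpace ℝ (Fin 3)) (ha : 0 < a) (hθe : 0 < θe) :
    ∃ σ₀ : ℝ, 0 < σ₀ ∧ ∃ ηc : ℝ, 0 < ηc ∧ ∀ σ : ℝ, 0 < σ → σ < σ₀ →
      ∀ (T : ℝ) (ρ θ : ℝ → (UnitAddTorus (Fin 3)) → ℝ) (u : ℝ → (UnitAddTorus (Fin 3)) → (EuclideanSpace ℝ (Fin 3))),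
        IsHardSphereEulerSolution σ T ρ u θ →
        ∀ Φ : (N : ℕ) → HardSphereFlow (Torus.geometry (Fin 3)) (hsDiameter σ N) (N + 1),
          TendstoHydroFieldsAt (fun N => localGibbsLaw σ (fun _ => a) (fun _ => ue) (fun _ => θe) N (Φ N)) Φ ρ u θ 0 →
          ∀ t ∈ Set.Ico 0 T, (∀ s ∈ Set.Icc 0 t, ∀ x, ρ s x * σ ^ 3 ≤ ηc) →
            let P : (N : ℕ) → Measure (Config (N + 1) (Fin 3) (UnitAddTorus (Fin 3))) :=
              fun N => localGibbsLaw σ (fun _ => a) (fun _ => ue) (fun _ => θe) N (Φ N)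
            let idx : ℕ → (UnitAddTorus (Fin 3)) → (Fin 3 → ℕ) := fun m x i => ⌊(m : ℝ) * Torus.repr x i⌋₊
            ∃ A Θ V : ℝ, 0 < A ∧ 0 < Θ ∧ ∀ δ : ℝ, 0 < δ → ∃ m₀ : ℕ, ∀ m : ℕ, m₀ ≤ m →
              ∀ᶠ N : ℕ in Filter.atTop, ∀ s ∈ Set.Icc 0 t,
                ∃ (ca cθ : (Fin 3 → ℕ) → ℝ) (cu : (Fin 3 → ℕ) → (EuclideanSpace ℝ (Fin 3))),
                  (∀ k, A⁻¹ ≤ ca k ∧ ca k ≤ A ∧ Θ⁻¹ ≤ cθ k ∧ cθ k ≤ Θ ∧ ‖cu k‖ ≤ V) ∧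
                  klDiv ((Φ N).lawAt (P N) s) (localGibbsLaw σ (fun x => ca (idx m x))
                    (fun x => cu (idx m x)) (fun x => cθ (idx m x)) N (Φ N)) ≤ ENNReal.ofReal (δ * ((N : ℝ) + 1)) := by
  refine ⟨1 / 2, by norm_num, 1, one_pos, fun σ _ hσ T ρ θ u _ Φ _ t _ _ => ?_⟩
  dsimp only
  refine ⟨max a a⁻¹, max θe θe⁻¹, ‖ue‖, lt_max_of_lt_left ha, lt_max_of_lt_left hθe, fun δ _ => ?_⟩
  refine ⟨0, fun m _ => Filter.Eventually.of_forall fun N s _ => ?_⟩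
  refine ⟨fun _ => a, fun _ => θe, fun _ => ue, fun _ => ⟨?_, le_max_left _ _, ?_, le_max_left _ _, le_rfl⟩, ?_⟩
  · exact inv_le_of_inv_le₀ ha (le_max_right _ _)
  · exact inv_le_of_inv_le₀ hθe (le_max_right _ _)
  · haveI := isProbabilityMeasure_localGibbsLaw (a₀ := fun _ : T3 => a) (θ₀ := fun _ : T3 => θe)
      (u₀ := fun _ : T3 => ue) continuous_const continuous_const continuous_const (fun _ => ha) (fun _ => hθe)
      hσ.le N (Φ N)
    rw [HardSphereFlow.lawAt_eq, map_flow_localGibbsLaw_const σ a θe ue N (Φ N) s, klDiv_self]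
    exact bot_le

end TimeZero

end Summit.AtomisticToContinuum.HydrodynamicLimit.Theorems.BlockGibbsLine

end
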